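import Mathlib
import Summits.KontsevichZagierPeriods.Zeta5Search.BrickFrobeniusAllPrimes
import Summits.KontsevichZagierPeriods.Zeta5Search.BrickCellsAllPrimes
import Summits.KontsevichZagierPeriods.Zeta5Search.BrickFrobeniusTwoOddRowEven

/-!
# BrickResidueLawTwo — the RESIDUE LAW at the prime `2` for every pole of every row of the CENTRE-FREE brick kernel:
`v₂(2^{(L+1)d}·laurent(n, j, d) − λ_j·2^{Ld}·laurent(N, K, d)) ≥ L+1` for `n ∈ {2N, 2N+1}`, `j ∈ {2K, 2K+1}`, `N < 2^{L+1}`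
(the `p = 2` counterpart of `BrickResidueLawCirc.residueLaw_circ_depth`; cell `pub-zeta5`, seat ct-1 g42)

HONEST FRAMING: systematic search; no irrationality claim unless certified.  INSTRUMENT valuations of the Laurent coefficients
`laurent A B 0 n K d = [T^d](T^A·R_n(−K+T))` of the centre-free brick kernels (`BrickLaurent`); nothing about `ζ(5)`/`ζ(3)`; no
`γ`/record statement; records in print UNMOVED; NOTHING IS DISCHARGED (net named-fact debt 0).

WHY: the one-level REDUCTION of the zeta5-irr chain (`BrickLevelReduction*`, odd `p`) rests on the residue law for the ° cells
(`BrickResidueLawCirc`, via the digit strip) and the negligibility of holes.  At `p = 2` the four pole types of the centre-free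
kernel are now covered by explicit one-step identities — (B1) with its sign for `(2N, 2K)` (`BrickFrobeniusAllPrimes`), holes
`(2N, 2K+1)` (`BrickHoleCellsAllPrimes`), and the odd-row factorisations `(2N+1, 2K+1)`, `(2N+1, 2K)`
(`BrickFrobeniusTwoOddRow{,Even}`) — and this file reads off the residue law from them, with NO parity hypothesis left:

* **`residueLaw_two_even`** — `n = 2N`, `j = 2K`: `λ = (−1)^{NB}·φ_0`; the remainder terms carry `φ_m ∈ 2^mℤ_(2)`, `m ≥ 1`;
* **`residueLaw_two_odd_odd`** — `n = 2N+1`, `j = 2K+1`: `λ = 2^B·w_0`; the remainder carries the factor `2^B`, `B ≥ 1`;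
* **`residueLaw_two_odd_even`** — `n = 2N+1`, `j = 2K`: `λ = 2^B·w′_0`;
* `cTop_two_even`, `cTop_two_odd_odd`, `cTop_two_odd_even` — the top coefficients: `c̃_{j,A}(n) = λ·c̃_{K,A}(N)` with these `λ`
  (so `λ` IS the chain's `λ_j = c̃_{j,A}(n)/c̃_{K,A}(N)` of `BrickLevelReduction.blockWeight`).
In each case: for `N < 2^{L+1}`, `K ≤ N`, `2B ≤ A` (`1 ≤ B` on odd rows) and every depth `d`,
`v₂(2^{(L+1)d}·laurent(n, j, d) − λ·(2^{Ld}·laurent(N, K, d))) ≤ exp(−(L+1))`.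

Theorems only (0 `def`); tree vocabulary; nothing restated.  What this does NOT do: the harmonic cell (`cellZero`; needs the
`p = 2` harmonic shift `2^s H_{2K+k₀}^{(s)} = H_K^{(s)} + 2^s·(odd part)`), the block-weight admissibility step, the assembly.
-/

namespace Summit.KontsevichZagierPeriods.Zeta5Search.BrickResidueLawTwo

open Finset Nat Polynomial WithZero
open Summit.KontsevichZagierPeriods.Zeta5Search.BrickTopCoefficient (cTop)
open Summit.KontsevichZagierPeriods.Zeta5Search.BrickLaurent (expandAt laurent laurent_zero phiCoeff)
open Summit.KontsevichZagierPeriods.Zeta5Search.ScaledSeries (IsSlopeInt)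
open Summit.KontsevichZagierPeriods.Zeta5Search.BrickPhiAllPrimes (padicValuation_phiCoeff_le_exp_neg)
open Summit.KontsevichZagierPeriods.Zeta5Search.BrickFrobeniusAllPrimes (laurent_frobenius_sign)
open Summit.KontsevichZagierPeriods.Zeta5Search.BrickCellsAllPrimes (laurent_zero_valuation_abs)
open Summit.KontsevichZagierPeriods.Zeta5Search.BrickFrobeniusTwoOddRow (laurent_two_odd_odd isSlopeInt_psiSeries)
open Summit.KontsevichZagierPeriods.Zeta5Search.BrickFrobeniusTwoOddRowEven (laurent_two_odd_even isSlopeInt_psi'Series)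

noncomputable section

/-- `v₂(2) = exp(−1)`. -/
theorem padicValuation_two : Rat.padicValuation 2 (2 : ℚ) = exp (-1 : ℤ) := by
  rw [show (2 : ℚ) = ((2 : ℕ) : ℚ) by norm_num, Rat.padicValuation_self]

/-- `v₂(2^e) = exp(−e)`. -/
theorem padicValuation_two_pow (e : ℕ) : Rat.padicValuation 2 ((2 : ℚ) ^ e) = exp (-(e : ℤ)) := by
  rw [map_pow, padicValuation_two, ← exp_nsmul, nsmul_eq_mul, mul_neg_one]

/-- The remainder estimate common to the three cases: if every term of `Σ_{(m,e) ∈ antidiagonal d} u_{m+1}·laurent(N,K,e)` has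
`v₂(u_{m+1}) ≤ exp(−c)`, then `v₂(2^{L(d+1)}·Σ u_{m+1} laurent(N,K,e)) ≤ exp(−(L+c))` (`2^{Le}laurent(N,K,e) ∈ ℤ_(2)` for
`N < 2^{L+1}`, `BrickCellsAllPrimes.laurent_zero_valuation_abs`).  Stated for a general coefficient sequence `u`. -/
theorem remainder_le {A B : ℕ} (hAB : 2 * B ≤ A) {L N K : ℕ} (hN : N < 2 ^ (L + 1)) (hK : K ≤ N) (d : ℕ)
    {u : ℕ → ℚ} {c : ℤ} (hu : ∀ m, Rat.padicValuation 2 (u (m + 1)) ≤ exp (-c)) :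
    Rat.padicValuation 2 ((2 : ℚ) ^ (L * (d + 1)) *
        ∑ x ∈ antidiagonal d, u (x.1 + 1) * laurent A B 0 N K x.2) ≤ exp (-((L : ℤ) + c)) := by
  rw [map_mul, padicValuation_two_pow]
  have hsum : Rat.padicValuation 2 (∑ x ∈ antidiagonal d, u (x.1 + 1) * laurent A B 0 N K x.2) ≤ exp (-c + (L : ℤ) * d) := by
    refine Valuation.map_sum_le _ fun x hx => ?_
    have hxd := mem_antidiagonal.1 hx
    have hx2 : (x.2 : ℤ) ≤ d := by exact_mod_cast (by omega : x.2 ≤ d)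
    rw [map_mul]
    calc _ ≤ exp (-c) * exp ((L : ℤ) * x.2) := mul_le_mul' (hu x.1) (laurent_zero_valuation_abs hAB hN hK x.2)
      _ ≤ _ := by rw [← exp_add, exp_le_exp]; nlinarith [Int.natCast_nonneg L, hx2]
  calc _ ≤ exp (-((L * (d + 1) : ℕ) : ℤ)) * exp (-c + (L : ℤ) * d) := mul_le_mul' le_rfl hsum
    _ ≤ _ := by rw [← exp_add, exp_le_exp]; push_cast; nlinarith

/-! ## Even row `2N`, even pole `2K`: `λ = (−1)^{NB}·φ_0` -/

section even

variable {A B : ℕ} (hAB : 2 * B ≤ A) {L N K : ℕ} (hN : N < 2 ^ (L + 1)) (hK : K ≤ N)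
include hAB hK

/-- The top coefficients: `c̃_{2K,A}(2N) = (−1)^{NB}·φ_0·c̃_{K,A}(N)` (`φ_0 = phiCoeff A B 2 N K 0`). -/
theorem cTop_two_even :
    cTop A B 0 (N * 2) (K * 2) = (-1) ^ (N * B) * phiCoeff A B 2 N K 0 * cTop A B 0 N K := by
  have h := laurent_frobenius_sign Nat.prime_two hAB 0 hK 0
  rw [show N * (2 - 1) * B = N * B by norm_num, pow_zero, one_mul, mul_one, Finset.Nat.antidiagonal_zero,
    Finset.sum_singleton] at h
  dsimp only at h
  rw [laurent_zero hAB 0 (Nat.mul_le_mul_right 2 hK), laurent_zero hAB 0 hK] at h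
  rw [h, mul_assoc]

include hN

/-- **Residue law at `2`, even row, even pole**: for `N < 2^{L+1}`, `K ≤ N`, every `d`:
`v₂(2^{(L+1)d}·laurent(2N, 2K, d) − (−1)^{NB}φ_0·(2^{Ld}·laurent(N, K, d))) ≤ exp(−(L+1))`
(remainder terms `φ_m·laurent(N,K,d−m)`, `m ≥ 1`, with `φ_m ∈ 2^mℤ_(2)` and `2^{L(d−m)}laurent(N,K,d−m) ∈ ℤ_(2)`). -/
theorem residueLaw_two_even (d : ℕ) :
    Rat.padicValuation 2 ((2 : ℚ) ^ ((L + 1) * d) * laurent A B 0 (N * 2) (K * 2) d -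
      (-1) ^ (N * B) * phiCoeff A B 2 N K 0 * ((2 : ℚ) ^ (L * d) * laurent A B 0 N K d)) ≤ exp (-((L : ℤ) + 1)) := by
  rcases d with _ | d
  · rw [mul_zero, mul_zero, pow_zero, one_mul, one_mul, laurent_zero hAB 0 (Nat.mul_le_mul_right 2 hK),
      laurent_zero hAB 0 hK, cTop_two_even hAB hK, sub_self, map_zero]
    exact zero_le
  have h := laurent_frobenius_sign Nat.prime_two hAB 0 hK (d + 1)
  rw [show N * (2 - 1) * B = N * B by norm_num, pow_zero, mul_one, Finset.Nat.sum_antidiagonal_succ] at h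
  dsimp only at h
  simp only [Nat.cast_ofNat] at h
  have key : (2 : ℚ) ^ ((L + 1) * (d + 1)) * laurent A B 0 (N * 2) (K * 2) (d + 1) -
      (-1) ^ (N * B) * phiCoeff A B 2 N K 0 * ((2 : ℚ) ^ (L * (d + 1)) * laurent A B 0 N K (d + 1)) =
      (-1) ^ (N * B) * ((2 : ℚ) ^ (L * (d + 1)) *
        ∑ x ∈ antidiagonal d, phiCoeff A B 2 N K (x.1 + 1) * laurent A B 0 N K x.2) := by
    have e : (2 : ℚ) ^ ((L + 1) * (d + 1)) = (2 : ℚ) ^ (L * (d + 1)) * (2 : ℚ) ^ (d + 1) := by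
      rw [← pow_add]; congr 1; ring
    rw [e, mul_assoc, h]
    ring
  rw [key, map_mul, map_pow, Valuation.map_neg, map_one, one_pow, one_mul]
  exact remainder_le hAB hN hK d (c := 1) fun m =>
    (padicValuation_phiCoeff_le_exp_neg A B N K (m + 1)).trans (exp_le_exp.2 (by push_cast; omega))

end even

/-! ## Odd row `2N+1`, odd pole `2K+1`: `λ = 2^B·w_0` -/

section oddOdd

variable {A B : ℕ} (hAB : 2 * B ≤ A) (hB : 1 ≤ B) {L N K : ℕ} (hN : N < 2 ^ (L + 1)) (hK : K ≤ N)
include hAB hK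

/-- The top coefficients: `c̃_{2K+1,A}(2N+1) = 2^B·w_0·c̃_{K,A}(N)`, `w_0 = Ψ_N(−K)·(−(K+N+1))^B`. -/
theorem cTop_two_odd_odd :
    cTop A B 0 (2 * N + 1) (2 * K + 1) = (2 : ℚ) ^ B *
      PowerSeries.coeff 0 (expandAt 0 (C ((∏ i ∈ range (N + 1), (2 * (i : ℚ) + 1)) ^ (A - 2 * B)) *
            ((∏ i ∈ Icc 1 N, (C (-(2 * (K : ℚ)) - 2 * i - 1) + C (2 : ℚ) * X)) *
              ∏ i ∈ range (N + 1), (C (-(2 * (K : ℚ)) + 2 * N + 2 * i + 1) + C (2 : ℚ) * X)) ^ B *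
            (X - C ((K : ℚ) + N + 1)) ^ B)
          ((∏ i ∈ range (N + 1), (C (2 * (i : ℚ) - 1 - 2 * K) + C (2 : ℚ) * X)) ^ A)) * cTop A B 0 N K := by
  have h := laurent_two_odd_odd hAB hK 0
  rw [pow_zero, one_mul, Finset.Nat.antidiagonal_zero, Finset.sum_singleton] at h
  dsimp only at h
  rw [laurent_zero hAB 0 (by omega : 2 * K + 1 ≤ 2 * N + 1), laurent_zero hAB 0 hK] at h
  rw [h]; ring

include hB hN

/-- **Residue law at `2`, odd row, odd pole**: for `N < 2^{L+1}`, `K ≤ N`, `1 ≤ B`, every `d`: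
`v₂(2^{(L+1)d}·laurent(2N+1, 2K+1, d) − 2^B w_0·(2^{Ld}·laurent(N, K, d))) ≤ exp(−(L+1))` (the remainder terms carry `2^B`). -/
theorem residueLaw_two_odd_odd (d : ℕ) :
    Rat.padicValuation 2 ((2 : ℚ) ^ ((L + 1) * d) * laurent A B 0 (2 * N + 1) (2 * K + 1) d -
      (2 : ℚ) ^ B * PowerSeries.coeff 0 (expandAt 0 (C ((∏ i ∈ range (N + 1), (2 * (i : ℚ) + 1)) ^ (A - 2 * B)) *
            ((∏ i ∈ Icc 1 N, (C (-(2 * (K : ℚ)) - 2 * i - 1) + C (2 : ℚ) * X)) *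
              ∏ i ∈ range (N + 1), (C (-(2 * (K : ℚ)) + 2 * N + 2 * i + 1) + C (2 : ℚ) * X)) ^ B *
            (X - C ((K : ℚ) + N + 1)) ^ B)
          ((∏ i ∈ range (N + 1), (C (2 * (i : ℚ) - 1 - 2 * K) + C (2 : ℚ) * X)) ^ A)) *
        ((2 : ℚ) ^ (L * d) * laurent A B 0 N K d)) ≤ exp (-((L : ℤ) + 1)) := by
  set W := expandAt 0 (C ((∏ i ∈ range (N + 1), (2 * (i : ℚ) + 1)) ^ (A - 2 * B)) *
            ((∏ i ∈ Icc 1 N, (C (-(2 * (K : ℚ)) - 2 * i - 1) + C (2 : ℚ) * X)) *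
              ∏ i ∈ range (N + 1), (C (-(2 * (K : ℚ)) + 2 * N + 2 * i + 1) + C (2 : ℚ) * X)) ^ B *
            (X - C ((K : ℚ) + N + 1)) ^ B)
          ((∏ i ∈ range (N + 1), (C (2 * (i : ℚ) - 1 - 2 * K) + C (2 : ℚ) * X)) ^ A) with hW
  have hWint : IsSlopeInt 2 0 0 W := isSlopeInt_psiSeries A B N K
  rcases d with _ | d
  · rw [mul_zero, mul_zero, pow_zero, one_mul, one_mul, laurent_zero hAB 0 (by omega : 2 * K + 1 ≤ 2 * N + 1),
      laurent_zero hAB 0 hK, cTop_two_odd_odd hAB hK, sub_self, map_zero]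
    exact zero_le
  have h := laurent_two_odd_odd hAB hK (d + 1)
  rw [← hW, Finset.Nat.sum_antidiagonal_succ] at h
  dsimp only at h
  have key : (2 : ℚ) ^ ((L + 1) * (d + 1)) * laurent A B 0 (2 * N + 1) (2 * K + 1) (d + 1) -
      (2 : ℚ) ^ B * PowerSeries.coeff 0 W * ((2 : ℚ) ^ (L * (d + 1)) * laurent A B 0 N K (d + 1)) =
      (2 : ℚ) ^ B * ((2 : ℚ) ^ (L * (d + 1)) *
        ∑ x ∈ antidiagonal d, PowerSeries.coeff (x.1 + 1) W * laurent A B 0 N K x.2) := by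
    have e : (2 : ℚ) ^ ((L + 1) * (d + 1)) = (2 : ℚ) ^ (L * (d + 1)) * (2 : ℚ) ^ (d + 1) := by
      rw [← pow_add]; congr 1; ring
    rw [e, mul_assoc, h]
    ring
  rw [key, map_mul, padicValuation_two_pow]
  have hrem := remainder_le hAB hN hK d (c := 0) (u := fun m => PowerSeries.coeff m W) fun m => by
    have h1 := hWint (m + 1)
    rw [zero_mul, zero_add, exp_zero] at h1
    rwa [neg_zero, exp_zero]
  rw [add_zero] at hrem
  calc _ ≤ exp (-(B : ℤ)) * exp (-(L : ℤ)) := mul_le_mul' le_rfl hrem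
    _ ≤ _ := by rw [← exp_add, exp_le_exp]; omega

end oddOdd

/-! ## Odd row `2N+1`, even pole `2K`: `λ = 2^B·w′_0` -/

section oddEven

variable {A B : ℕ} (hAB : 2 * B ≤ A) (hB : 1 ≤ B) {L N K : ℕ} (hN : N < 2 ^ (L + 1)) (hK : K ≤ N)
include hAB hK

/-- The top coefficients: `c̃_{2K,A}(2N+1) = 2^B·w′_0·c̃_{K,A}(N)`, `w′_0 = Ψ′_N(−K)·(2N+1−K)^B`. -/
theorem cTop_two_odd_even :
    cTop A B 0 (2 * N + 1) (2 * K) = (2 : ℚ) ^ B *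
      PowerSeries.coeff 0 (expandAt 0 (C ((∏ i ∈ range (N + 1), (2 * (i : ℚ) + 1)) ^ (A - 2 * B)) *
            ((∏ i ∈ range (N + 1), (C (-(2 * (K : ℚ)) - 2 * i - 1) + C (2 : ℚ) * X)) *
              ∏ i ∈ Icc 1 N, (C (-(2 * (K : ℚ)) + 2 * N + 2 * i + 1) + C (2 : ℚ) * X)) ^ B *
            (X + C (((2 * N + 1 : ℕ) : ℚ) - K)) ^ B)
          ((∏ i ∈ range (N + 1), (C (2 * (i : ℚ) + 1 - 2 * K) + C (2 : ℚ) * X)) ^ A)) * cTop A B 0 N K := by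
  have h := laurent_two_odd_even hAB hK 0
  rw [pow_zero, one_mul, Finset.Nat.antidiagonal_zero, Finset.sum_singleton] at h
  dsimp only at h
  rw [laurent_zero hAB 0 (by omega : 2 * K ≤ 2 * N + 1), laurent_zero hAB 0 hK] at h
  rw [h]; ring

include hB hN

/-- **Residue law at `2`, odd row, even pole**: for `N < 2^{L+1}`, `K ≤ N`, `1 ≤ B`, every `d`:
`v₂(2^{(L+1)d}·laurent(2N+1, 2K, d) − 2^B w′_0·(2^{Ld}·laurent(N, K, d))) ≤ exp(−(L+1))`. -/
theorem residueLaw_two_odd_even (d : ℕ) :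
    Rat.padicValuation 2 ((2 : ℚ) ^ ((L + 1) * d) * laurent A B 0 (2 * N + 1) (2 * K) d -
      (2 : ℚ) ^ B * PowerSeries.coeff 0 (expandAt 0 (C ((∏ i ∈ range (N + 1), (2 * (i : ℚ) + 1)) ^ (A - 2 * B)) *
            ((∏ i ∈ range (N + 1), (C (-(2 * (K : ℚ)) - 2 * i - 1) + C (2 : ℚ) * X)) *
              ∏ i ∈ Icc 1 N, (C (-(2 * (K : ℚ)) + 2 * N + 2 * i + 1) + C (2 : ℚ) * X)) ^ B *
            (X + C (((2 * N + 1 : ℕ) : ℚ) - K)) ^ B)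
          ((∏ i ∈ range (N + 1), (C (2 * (i : ℚ) + 1 - 2 * K) + C (2 : ℚ) * X)) ^ A)) *
        ((2 : ℚ) ^ (L * d) * laurent A B 0 N K d)) ≤ exp (-((L : ℤ) + 1)) := by
  set W := expandAt 0 (C ((∏ i ∈ range (N + 1), (2 * (i : ℚ) + 1)) ^ (A - 2 * B)) *
            ((∏ i ∈ range (N + 1), (C (-(2 * (K : ℚ)) - 2 * i - 1) + C (2 : ℚ) * X)) *
              ∏ i ∈ Icc 1 N, (C (-(2 * (K : ℚ)) + 2 * N + 2 * i + 1) + C (2 : ℚ) * X)) ^ B *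
            (X + C (((2 * N + 1 : ℕ) : ℚ) - K)) ^ B)
          ((∏ i ∈ range (N + 1), (C (2 * (i : ℚ) + 1 - 2 * K) + C (2 : ℚ) * X)) ^ A) with hW
  have hWint : IsSlopeInt 2 0 0 W := isSlopeInt_psi'Series A B N K
  rcases d with _ | d
  · rw [mul_zero, mul_zero, pow_zero, one_mul, one_mul, laurent_zero hAB 0 (by omega : 2 * K ≤ 2 * N + 1),
      laurent_zero hAB 0 hK, cTop_two_odd_even hAB hK, sub_self, map_zero]
    exact zero_le
  have h := laurent_two_odd_even hAB hK (d + 1)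
  rw [← hW, Finset.Nat.sum_antidiagonal_succ] at h
  dsimp only at h
  have key : (2 : ℚ) ^ ((L + 1) * (d + 1)) * laurent A B 0 (2 * N + 1) (2 * K) (d + 1) -
      (2 : ℚ) ^ B * PowerSeries.coeff 0 W * ((2 : ℚ) ^ (L * (d + 1)) * laurent A B 0 N K (d + 1)) =
      (2 : ℚ) ^ B * ((2 : ℚ) ^ (L * (d + 1)) *
        ∑ x ∈ antidiagonal d, PowerSeries.coeff (x.1 + 1) W * laurent A B 0 N K x.2) := by
    have e : (2 : ℚ) ^ ((L + 1) * (d + 1)) = (2 : ℚ) ^ (L * (d + 1)) * (2 : ℚ) ^ (d + 1) := by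
      rw [← pow_add]; congr 1; ring
    rw [e, mul_assoc, h]
    ring
  rw [key, map_mul, padicValuation_two_pow]
  have hrem := remainder_le hAB hN hK d (c := 0) (u := fun m => PowerSeries.coeff m W) fun m => by
    have h1 := hWint (m + 1)
    rw [zero_mul, zero_add, exp_zero] at h1
    rwa [neg_zero, exp_zero]
  rw [add_zero] at hrem
  calc _ ≤ exp (-(B : ℤ)) * exp (-(L : ℤ)) := mul_le_mul' le_rfl hrem
    _ ≤ _ := by rw [← exp_add, exp_le_exp]; omega

end oddEven

end

end Summit.KontsevichZagierPeriods.Zeta5Search.BrickResidueLawTwo
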